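import Summits.QuantumAdvantage.QuantumAdvantage.Theorems.ArithStatLadderIqThreeNotPPolyStubFundDensityNG
import Summits.QuantumAdvantage.QuantumAdvantage.Theorems.ArithStatLadderIqThreeNotPPolyStubNagellHit
import Literature.Computability.Complexity.TM2PassThrough

/-!
# Crux `ArithStatLadder.IqThreeNotPPoly` (stmt-QuantumAdvantage-2422): Nagell's theorem — `IQ3` is infinite

By-product of line `Sketch` v4 (gen-1 lead): **there are infinitely many negative fundamental
discriminants `−d` with `3 ∣ h(−d)`** (T. Nagell 1922), i.e. the crux's set
`S = {d : −d fundamental ∧ 3 ∣ h(−d)}` is infinite — the infinitude the standing disprover's file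
records as "not formalised" (Disproof.lean §4(d)/§5: the crux needs an infinite language even to be
non-trivial). Proof: for every bit-length `n ≥ n₀` take a Bertrand prime `N ∈ (2^{n−1}, 2^n)`
(squarefree, `|bin N| = n`); by the YES-density of the Nagell sampler (`stub_fundDensityNG`) some
seed `k < 2^{8n+48}` makes `−d`, `d = N s (4c³ − N s)`, fundamental, and then `3 ∣ h(−d)`
(`stub_nagellHit`); finally `d ≥ N ≥ 2^{n−1}` is as large as we please. Theorems only; sorry-free.
-/

set_option linter.dupNamespace false -- D-0017: single-problem summit ⇒ `QuantumAdvantage.QuantumAdvantage` by design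

namespace Summit.QuantumAdvantage.QuantumAdvantage.Theorems.IqThreeNotPPoly

open scoped Classical
open _root_.Computability Literature.Computability.Complexity
open Literature.Computability.Cryptography (IsNegFundamentalDiscr)
open Literature.NumberTheory.QuadraticFields (BinaryQuadraticForm.classNumber)

/-- A Bertrand prime of prescribed bit-length: for `n ≥ 2` there is a prime `N` with
`|bin N| = n` (i.e. `2^{n−1} ≤ N < 2^n`). [folklore] -/
theorem nagellInf_exists_prime_length (n : ℕ) (hn : 2 ≤ n) :
    ∃ N : ℕ, N.Prime ∧ (encodeNat N).length = n ∧ 2 ^ (n - 1) ≤ N := by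
  obtain ⟨p, hp, hlt, hle⟩ := Nat.exists_prime_lt_and_le_two_mul (2 ^ (n - 1)) (by positivity)
  have h2 : 2 * 2 ^ (n - 1) = 2 ^ n := by
    rw [← pow_succ']; congr 1; omega
  rw [h2] at hle
  have hplt : p < 2 ^ n := by
    rcases Nat.lt_or_eq_of_le hle with h | h
    · exact h
    · exfalso
      have h4 : 4 ≤ 2 ^ n := by
        calc (4 : ℕ) = 2 ^ 2 := by norm_num
          _ ≤ 2 ^ n := Nat.pow_le_pow_right Nat.two_pos hn
      have htwo : 2 ∣ p := by
        rw [h, show n = (n - 1) + 1 by omega, pow_succ]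
        exact dvd_mul_left 2 _
      rcases (Nat.dvd_prime hp).1 htwo with h1 | h1
      · omega
      · omega
  refine ⟨p, hp, ?_, hlt.le⟩
  rw [TM2Pass.length_encodeNat_eq_size]
  apply le_antisymm
  · exact Nat.size_le.2 hplt
  · have : n - 1 < Nat.size p := Nat.lt_size.2 hlt.le
    omega

/-- **Nagell's theorem (1922): infinitely many imaginary quadratic fields have class number
divisible by `3`** — the crux's set `{d : −d fundamental ∧ 3 ∣ h(−d)}` is infinite. From the
YES-density of the Nagell sampler at Bertrand primes of every large bit-length and Nagell's
elementary 3-torsion. [cite: Nagell1922, §1] -/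
theorem iqThreeSet_infinite :
    Set.Infinite {d : ℕ | IsNegFundamentalDiscr d ∧ 3 ∣ BinaryQuadraticForm.classNumber (-(d : ℤ))} := by
  obtain ⟨n₀, hdens⟩ := stub_fundDensityNG
  refine Set.infinite_of_forall_exists_gt fun X => ?_
  -- a bit-length `n ≥ max n₀ 2` with `2^{n-1} > X`
  set n : ℕ := max n₀ 2 + X + 1 with hn
  have hn₀ : n₀ ≤ n := by omega
  have hn2 : 2 ≤ n := by omega
  obtain ⟨N, hN, hlen, hNge⟩ := nagellInf_exists_prime_length n hn2
  have hsq : Squarefree N := hN.squarefree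
  have h := hdens n hn₀ N hsq hlen
  -- some seed is good
  have hne : ((Finset.range (2 ^ (8 * n + 48))).filter (fun k =>
      IsNegFundamentalDiscr (N * (1 + 6 * (1 + 2 ^ 30 * N ^ 5) * N * k) *
        (4 * (1 + 2 ^ 30 * N ^ 5) ^ 3 - N * (1 + 6 * (1 + 2 ^ 30 * N ^ 5) * N * k))))).Nonempty := by
    rw [← Finset.card_pos]
    have hK : 0 < 2 ^ (8 * n + 48) := by positivity
    omega
  obtain ⟨k, hk⟩ := hne
  have hfund := (Finset.mem_filter.1 hk).2
  refine ⟨_, ⟨hfund, stub_nagellHit N k hfund⟩, ?_⟩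
  -- `X < d`: `d ≠ 0` forces both trailing factors `≥ 1`, so `d ≥ N ≥ 2^{n-1} > X`
  set d : ℕ := N * (1 + 6 * (1 + 2 ^ 30 * N ^ 5) * N * k) *
    (4 * (1 + 2 ^ 30 * N ^ 5) ^ 3 - N * (1 + 6 * (1 + 2 ^ 30 * N ^ 5) * N * k)) with hd
  have hd0 : d ≠ 0 := by
    intro h0
    rw [h0] at hfund
    rcases hfund with ⟨h1, -, -⟩ | ⟨-, h2, -⟩
    · norm_num at h1
    · norm_num at h2
  have hw : 1 ≤ 4 * (1 + 2 ^ 30 * N ^ 5) ^ 3 - N * (1 + 6 * (1 + 2 ^ 30 * N ^ 5) * N * k) := by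
    rcases Nat.eq_zero_or_pos (4 * (1 + 2 ^ 30 * N ^ 5) ^ 3 - N * (1 + 6 * (1 + 2 ^ 30 * N ^ 5) * N * k))
      with h0 | h0
    · exfalso; apply hd0; rw [hd, h0, mul_zero]
    · exact h0
  have hs : 1 ≤ 1 + 6 * (1 + 2 ^ 30 * N ^ 5) * N * k := Nat.le_add_right 1 _
  have hdN : N ≤ d := by
    calc N = N * 1 * 1 := by ring
      _ ≤ d := Nat.mul_le_mul (Nat.mul_le_mul le_rfl hs) hw
  have hX : X < 2 ^ (n - 1) := by
    have h1 : X < n - 1 := by omega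
    exact h1.trans (n - 1).lt_two_pow_self
  change X < d
  omega

end Summit.QuantumAdvantage.QuantumAdvantage.Theorems.IqThreeNotPPoly
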